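/-
Copyright (c) 2026 the pub-hodgecm-mathlib formalisation cell (harness21).  Prover seat hodgecm-mathlib-LH4-p08 (g4), Track A «(D-RAM) FOUR-FRAME», unit U2H, the census leaf
(ρ2b′-X) `stub_U2H_fixedPointCensus_typeTwo_unit0` — dealer LH4-plan (g12) WORD #16∕#21 hand T5a «TORIC LEVEL CENSUS, K-UNRAMIFIED» (payer LH4-p14 (g3); plan owner LH4-p12 (g4)):
the u-free level sets of the hyperbolic side as INDEX DIFFERENCES.  2026-09-04.
-/
import Literature.NumberTheory.LocalFields.QuadraticOrderLatticeClasses      -- ★ p857298 (this seat, F1): lattices ↔ cosets, coset bookkeeping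
import Literature.NumberTheory.LocalFields.QuadraticOrderLevelClassesRamified  -- ★ p857372 (LH4-p06 (g4), RamM twin): `v_eq_exp_iff_le_and_not_le` (discreteness); transitively ★ p857299∕p857226
import Literature.NumberTheory.LocalFields.QuadraticOrderNormTwistClasses    -- ★ p857299 (this seat): norm hom, twist, `B_r`, translation lemma → ★ p857226 (dichotomy, `|y − ρy| = |y|·|1 + ηt|`)
import HarnessLib

/-!
# The u-free LEVEL SETS of the toric census (M∕E-unramified frame), hyperbolic side, as index differences:
# `#{x₀𝒪_j : integral, Gram-primitive, |y| = |ϖ|^a} = [B_{j−a} : 𝒪_jˣ] − [B_{j−a+1} : 𝒪_jˣ]` (`a ≥ 1`, parity `2k = a − j − v(h)`), `= [B_j : 𝒪_jˣ]` (`a = 0`), `= 0` (parity fails)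
(Flicker 1998 p. 84 (Mars); Serre, *Local Fields* V §1–§3; Jacobowitz 1962 §4)

Topic `NumberTheory/LocalFields`; namespace `Literature.NumberTheory.LocalFields.QuadraticOrder`.  THEOREMS ONLY (no definition, no instance, no notation, no named fact, no `sorry`); kernel
lane `--supports stmt-HodgeConjecture-24833` (count-neutral).  Cell `pub/hodgecm-mathlib` (D-0151), crux H413, Track A «(D-RAM) FOUR-FRAME», unit U2H: the hyperbolic head (UNR+) of
this seat's T5a sheet (`Theorems/F0P3cDyRamToricLevelCensusUnr`, over the ★ DEFS leaf p857239) counts `levelSet j a` = the order lattices `x₀·𝒪_j` whose dual generator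
`y = h·x₀Θx₀·ϖ^j(α − ρα)` is INTEGRAL, GRAM-PRIMITIVE and of LEVEL `|y| = |ϖ|^a`.  THIS FILE performs the whole reduction of that count to subgroup indices, in ★ T4's one-field
currency with the predicates spelled out (the Summit DEFS are definitionally these):
* §1 GENERATOR NORMAL FORM `x₀ = ϖ^k·ω` (`|ω| = 1`; `ϖ` a uniformiser), the LEVEL `|y(ϖ^kω)| = exp(−(v(h) + 2k + j))`, the TWIST `t(ϖ^kω) = t(ω)`;
* §2 MEMBERSHIP: by ★ p857226's dichotomy, `x₀ = ϖ^kω` generates a member of the level-`a` set iff `v(h) + 2k + j = a` and — `a ≥ 1`: `|1 + η·t(ω)| = exp(a − j)` EXACTLY;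
  `a = 0`: `|1 + η·t(ω)| ≤ exp(−j)` — so the generators form `ϖ^{k₀}·D_a` with `D_a ⊆ U_M` a difference (resp. one) of the translated norm-depth cosets `ω₀·B_r` of ★ p857299, or the
  EMPTY set when `a − j − v(h)` is odd;
* §3 THE COUNT (★ F1 `ncard_setOf_orderLattice_eq_ncard_image_mk` + coset bookkeeping): **`ncard_levelSet_eq_zero_of_odd`**, **`ncard_levelSet_zero_eq_relIndex`** (`a = 0`),
  **`ncard_levelSet_eq_relIndex_sub`** (`a ≥ 1`), for subgroups `𝒪_jˣ, B_{j−a}, B_{j−a+1} ≤ Mˣ` characterised by membership.  The index VALUES are ★-GREEN `QuadraticOrderTorusIndices`.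
HONEST LABEL: HC_CM is proved only modulo the 7 printed citations (2 remaining named inputs: hLiu418 = stmt-HodgeConjecture-24832, h413 = stmt-HodgeConjecture-24833) until rung 0
closes; unconditional algebra, count-neutral (organ F4-U of the (ρ2b′-X) payer plan; the census VALUE appears only when the indices are substituted, in the Theorems head).

## References
* [Flicker1998UnitaryFL] Y. Z. Flicker, *Elementary proof of the fundamental lemma for a unitary group*, Canad. J. Math. 50 (1998): p. 84 REMARK (Mars' orders `R + π^j R_E` and `z·R_E(j)`).
* [Serre1979] J.-P. Serre, *Local Fields*, GTM 67 (1979): Ch. V §1, §3.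
* [Jacobowitz1962] R. Jacobowitz, *Hermitian forms over local fields*, Amer. J. Math. 84 (1962): §4.
-/

set_option autoImplicit false
open WithZero
open scoped Pointwise

namespace Literature.NumberTheory.LocalFields.QuadraticOrder

variable {K : Type*} [Field K] [Valued K ℤᵐ⁰] {ρ Θ : K →+* K} {α ϖ h η : K}

/-! ## §1 Generator normal form, level and twist -/

/-- `|ϖ| = exp(−1)` is non-zero and `|ϖ^k| = exp(−k)` for `k ∈ ℤ`. [cite: Serre1979, Ch. V §1] -/
theorem v_varpi_zpow (hϖ : Valued.v ϖ = exp (-1 : ℤ)) (k : ℤ) : ϖ ≠ 0 ∧ Valued.v (ϖ ^ k) = exp (-k) := by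
  have hϖ0 : ϖ ≠ 0 := fun h0 => by rw [h0, map_zero] at hϖ; exact (exp_ne_zero hϖ.symm).elim
  refine ⟨hϖ0, ?_⟩
  rw [map_zpow₀, hϖ, ← exp_zsmul, smul_eq_mul, mul_neg, mul_one]

/-- **GENERATOR NORMAL FORM**: every `x₀ ≠ 0` is `ϖ^k·ω` with `|ω| = 1`, `k = −log|x₀|` (`ϖ` a uniformiser: the value group is `|ϖ|^ℤ`). [cite: Serre1979, Ch. V §1] -/
theorem exists_eq_varpi_zpow_mul_unit (hϖ : Valued.v ϖ = exp (-1 : ℤ)) {x₀ : K} (hx₀ : x₀ ≠ 0) :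
    ∃ (k : ℤ) (ω : K), Valued.v ω = 1 ∧ x₀ = ϖ ^ k * ω := by
  obtain ⟨hϖ0, -⟩ := v_varpi_zpow hϖ 0
  have hv0 : Valued.v x₀ ≠ 0 := (Valuation.ne_zero_iff _).2 hx₀
  obtain ⟨n, hn⟩ : ∃ n : ℤ, Valued.v x₀ = exp n := ⟨_, (exp_log hv0).symm⟩
  refine ⟨-n, ϖ ^ n * x₀, ?_, ?_⟩
  · rw [map_mul, (v_varpi_zpow hϖ n).2, hn, ← exp_add, neg_add_cancel, exp_zero]
  · rw [← mul_assoc, ← zpow_add₀ hϖ0, neg_add_cancel, zpow_zero, one_mul]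

/-- **THE LEVEL OF `ϖ^k·ω`**: `|y| = exp(−(v_h + 2k + j))` for `y = h·(x₀Θx₀)·(ϖ^j(α − ρα))`, `x₀ = ϖ^kω`, `|ω| = 1`, `|h| = exp(−v_h)`, `|α − ρα| = 1`, `Θ` isometric.
[cite: Jacobowitz1962, §4] -/
theorem v_hermGen_varpi_zpow_mul (hvΘ : ∀ x, Valued.v (Θ x) = Valued.v x) (hα : Valued.v (α - ρ α) = 1) (hϖ : Valued.v ϖ = exp (-1 : ℤ))
    {vh : ℤ} (hvh : Valued.v h = exp (-vh)) (j : ℕ) {k : ℤ} {ω : K} (hω : Valued.v ω = 1) :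
    Valued.v (h * (ϖ ^ k * ω * Θ (ϖ ^ k * ω)) * (ϖ ^ j * (α - ρ α))) = exp (-(vh + 2 * k + j)) := by
  obtain ⟨-, hk⟩ := v_varpi_zpow hϖ k
  obtain ⟨-, hj⟩ := v_varpi_zpow hϖ j
  rw [zpow_natCast] at hj
  simp only [map_mul, hvΘ, hk, hω, hvh, hj, hα, mul_one, ← exp_add]
  congr 1; ring

/-! ## §2 Membership of the level-`a` set in generator normal form -/

/-- **MEMBERSHIP, `a ≥ 1`**: for `x₀ = ϖ^kω` (`|ω| = 1`) the dual generator `y` is integral and Gram-primitive of level `|y| = exp(−a)`, `1 ≤ a`, iff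
`v_h + 2k + j = a` and `|1 + η·t(ω)| = exp(a − j)` EXACTLY (`η = ρh∕h`; ★ p857226 dichotomy + `|y − ρy| = |y|·|1 + ηt|`; the twist is blind to `ϖ^k`). [cite: Jacobowitz1962, §4] -/
theorem hermGen_level_iff_of_pos (hρρ : ∀ x, ρ (ρ x) = x) (hΘρ : ∀ x, Θ (ρ x) = ρ (Θ x)) (hvΘ : ∀ x, Valued.v (Θ x) = Valued.v x)
    (hα : Valued.v (α - ρ α) = 1) (hϖ : Valued.v ϖ = exp (-1 : ℤ)) (hρϖ : ρ ϖ = ϖ) (hh : h ≠ 0) {vh : ℤ} (hvh : Valued.v h = exp (-vh))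
    (j : ℕ) {a : ℕ} (ha : 1 ≤ a) {k : ℤ} {ω : K} (hω : Valued.v ω = 1) :
    (((Valued.v (h * (ϖ ^ k * ω * Θ (ϖ ^ k * ω)) * (ϖ ^ j * (α - ρ α))) ≤ 1 ∧
          Valued.v (h * (ϖ ^ k * ω * Θ (ϖ ^ k * ω)) * (ϖ ^ j * (α - ρ α)) - ρ (h * (ϖ ^ k * ω * Θ (ϖ ^ k * ω)) * (ϖ ^ j * (α - ρ α)))) ≤
            Valued.v (ϖ ^ j * (α - ρ α))) ∧
        ¬ (Valued.v (h * (ϖ ^ k * ω * Θ (ϖ ^ k * ω)) * (ϖ ^ j * (α - ρ α)) / ϖ) ≤ 1 ∧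
            Valued.v (h * (ϖ ^ k * ω * Θ (ϖ ^ k * ω)) * (ϖ ^ j * (α - ρ α)) / ϖ - ρ (h * (ϖ ^ k * ω * Θ (ϖ ^ k * ω)) * (ϖ ^ j * (α - ρ α)) / ϖ)) ≤
              Valued.v (ϖ ^ j * (α - ρ α)))) ∧
      Valued.v (h * (ϖ ^ k * ω * Θ (ϖ ^ k * ω)) * (ϖ ^ j * (α - ρ α))) = exp (-(a : ℤ))) ↔
    (vh + 2 * k + j = a ∧ Valued.v (1 + ρ h / h * (ρ (ω * Θ ω) / (ω * Θ ω))) = exp ((a : ℤ) - j)) := by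
  obtain ⟨hϖ0, hk⟩ := v_varpi_zpow hϖ k
  have hc0 : ϖ ^ j ≠ 0 := pow_ne_zero j hϖ0
  have hx₀ : ϖ ^ k * ω ≠ 0 := mul_ne_zero (zpow_ne_zero k hϖ0) (fun h0 => by rw [h0, map_zero] at hω; exact zero_ne_one hω)
  have hΘx₀ : Θ (ϖ ^ k * ω) ≠ 0 := (map_ne_zero Θ).2 hx₀
  have hρc : ρ (ϖ ^ j) = ϖ ^ j := by rw [map_pow, hρϖ]
  have hlev := v_hermGen_varpi_zpow_mul (ρ := ρ) hvΘ hα hϖ hvh j (k := k) hω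
  have htw : ρ (ϖ ^ k * ω * Θ (ϖ ^ k * ω)) / (ϖ ^ k * ω * Θ (ϖ ^ k * ω)) = ρ (ω * Θ ω) / (ω * Θ ω) :=
    twist_eq_of_fixed_mul hΘρ (by rw [map_zpow₀, hρϖ]) (zpow_ne_zero k hϖ0) ω
  have hvc : Valued.v (ϖ ^ j) = exp (-(j : ℤ)) := by have := (v_varpi_zpow hϖ j).2; rwa [zpow_natCast] at this
  rw [hermGen_order_and_not_order_div_iff hα hϖ hρϖ hc0, v_hermGen_sub_map_eq hρρ hρc hh hx₀ hΘx₀, htw, hlev, hvc]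
  constructor
  · rintro ⟨hdisj, hlevel⟩
    have hkj : vh + 2 * k + j = a := by
      have := hlevel; rw [exp_inj] at this; omega
    refine ⟨hkj, ?_⟩
    rcases hdisj with ⟨h1, -⟩ | ⟨-, h2⟩
    · -- `|y| = 1` contradicts `a ≥ 1`
      rw [← exp_zero, exp_inj] at h1
      exfalso; omega
    · rw [hkj] at h2
      have hne : exp (-(a : ℤ)) ≠ 0 := exp_ne_zero
      have hX : Valued.v (1 + ρ h / h * (ρ (ω * Θ ω) / (ω * Θ ω))) = exp (-(j : ℤ)) / exp (-(a : ℤ)) :=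
        (eq_div_iff hne).2 (by rw [mul_comm]; exact h2)
      rw [hX, ← exp_sub]; congr 1; ring
  · rintro ⟨hkj, hdep⟩
    refine ⟨Or.inr ⟨?_, ?_⟩, by rw [hkj]⟩
    · rw [hkj, ← exp_zero, exp_le_exp]; omega
    · rw [hkj, hdep, ← exp_add]; congr 1; ring

/-- **MEMBERSHIP, `a = 0`**: `x₀ = ϖ^kω` generates an integral Gram-primitive lattice of level `0` iff `v_h + 2k + j = 0` and `|1 + η·t(ω)| ≤ exp(−j)`. [cite: Jacobowitz1962, §4] -/
theorem hermGen_level_iff_zero (hρρ : ∀ x, ρ (ρ x) = x) (hΘρ : ∀ x, Θ (ρ x) = ρ (Θ x)) (hvΘ : ∀ x, Valued.v (Θ x) = Valued.v x)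
    (hα : Valued.v (α - ρ α) = 1) (hϖ : Valued.v ϖ = exp (-1 : ℤ)) (hρϖ : ρ ϖ = ϖ) (hh : h ≠ 0) {vh : ℤ} (hvh : Valued.v h = exp (-vh))
    (j : ℕ) {k : ℤ} {ω : K} (hω : Valued.v ω = 1) :
    (((Valued.v (h * (ϖ ^ k * ω * Θ (ϖ ^ k * ω)) * (ϖ ^ j * (α - ρ α))) ≤ 1 ∧
          Valued.v (h * (ϖ ^ k * ω * Θ (ϖ ^ k * ω)) * (ϖ ^ j * (α - ρ α)) - ρ (h * (ϖ ^ k * ω * Θ (ϖ ^ k * ω)) * (ϖ ^ j * (α - ρ α)))) ≤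
            Valued.v (ϖ ^ j * (α - ρ α))) ∧
        ¬ (Valued.v (h * (ϖ ^ k * ω * Θ (ϖ ^ k * ω)) * (ϖ ^ j * (α - ρ α)) / ϖ) ≤ 1 ∧
            Valued.v (h * (ϖ ^ k * ω * Θ (ϖ ^ k * ω)) * (ϖ ^ j * (α - ρ α)) / ϖ - ρ (h * (ϖ ^ k * ω * Θ (ϖ ^ k * ω)) * (ϖ ^ j * (α - ρ α)) / ϖ)) ≤
              Valued.v (ϖ ^ j * (α - ρ α)))) ∧
      Valued.v (h * (ϖ ^ k * ω * Θ (ϖ ^ k * ω)) * (ϖ ^ j * (α - ρ α))) = exp (-((0 : ℕ) : ℤ))) ↔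
    (vh + 2 * k + j = 0 ∧ Valued.v (1 + ρ h / h * (ρ (ω * Θ ω) / (ω * Θ ω))) ≤ exp (-(j : ℤ))) := by
  obtain ⟨hϖ0, hk⟩ := v_varpi_zpow hϖ k
  have hc0 : ϖ ^ j ≠ 0 := pow_ne_zero j hϖ0
  have hx₀ : ϖ ^ k * ω ≠ 0 := mul_ne_zero (zpow_ne_zero k hϖ0) (fun h0 => by rw [h0, map_zero] at hω; exact zero_ne_one hω)
  have hΘx₀ : Θ (ϖ ^ k * ω) ≠ 0 := (map_ne_zero Θ).2 hx₀
  have hρc : ρ (ϖ ^ j) = ϖ ^ j := by rw [map_pow, hρϖ]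
  have hlev := v_hermGen_varpi_zpow_mul (ρ := ρ) hvΘ hα hϖ hvh j (k := k) hω
  have htw : ρ (ϖ ^ k * ω * Θ (ϖ ^ k * ω)) / (ϖ ^ k * ω * Θ (ϖ ^ k * ω)) = ρ (ω * Θ ω) / (ω * Θ ω) :=
    twist_eq_of_fixed_mul hΘρ (by rw [map_zpow₀, hρϖ]) (zpow_ne_zero k hϖ0) ω
  have hvc : Valued.v (ϖ ^ j) = exp (-(j : ℤ)) := by have := (v_varpi_zpow hϖ j).2; rwa [zpow_natCast] at this
  rw [hermGen_order_and_not_order_div_iff hα hϖ hρϖ hc0, v_hermGen_sub_map_eq hρρ hρc hh hx₀ hΘx₀, htw, hlev, hvc]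
  simp only [Nat.cast_zero, neg_zero]
  constructor
  · rintro ⟨hdisj, hlevel⟩
    have hkj : vh + 2 * k + j = 0 := by
      have := hlevel; rw [exp_inj] at this; omega
    refine ⟨hkj, ?_⟩
    have h0 : exp (-(vh + 2 * k + j)) = (1 : ℤᵐ⁰) := by rw [hkj, neg_zero, exp_zero]
    rcases hdisj with ⟨-, h2⟩ | ⟨-, h2⟩
    · rwa [h0, one_mul] at h2
    · rw [h0, one_mul] at h2; exact h2.le
  · rintro ⟨hkj, hdep⟩
    have h0 : exp (-(vh + 2 * k + j)) = (1 : ℤᵐ⁰) := by rw [hkj, neg_zero, exp_zero]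
    exact ⟨Or.inl ⟨h0, by rw [h0, one_mul]; exact hdep⟩, by rw [h0, exp_zero]⟩

/-! ## §3 The generator sets in `Mˣ` and the counts -/

-- (discreteness `|x| = exp n ⟺ |x| ≤ exp n ∧ ¬ |x| ≤ exp(n − 1)` is ★ `v_eq_exp_iff_le_and_not_le` of `QuadraticOrderLevelClassesRamified`, LH4-p06 (g4) p857372)

/-- **THE LEVEL-`a` GENERATORS, `a ≥ 1`, EVEN PARITY**: with `2k₀ = a − j − v_h`, the `x₀ ∈ Mˣ` generating an integral Gram-primitive lattice of level `a` are EXACTLY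
`ϖ^{k₀}·{ω : |ω| = 1, |1 + η·t(ω)| = exp(a − j)}`. [cite: Jacobowitz1962, §4] [cite: Flicker1998UnitaryFL, p. 84] -/
theorem setOf_levelGen_eq_smul_of_pos (hρρ : ∀ x, ρ (ρ x) = x) (hΘρ : ∀ x, Θ (ρ x) = ρ (Θ x)) (hvΘ : ∀ x, Valued.v (Θ x) = Valued.v x)
    (hα : Valued.v (α - ρ α) = 1) (hϖ : Valued.v ϖ = exp (-1 : ℤ)) (hρϖ : ρ ϖ = ϖ) (hϖ0 : ϖ ≠ 0) (hh : h ≠ 0) {vh : ℤ} (hvh : Valued.v h = exp (-vh))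
    (j : ℕ) {a : ℕ} (ha : 1 ≤ a) {k₀ : ℤ} (hk₀ : vh + 2 * k₀ + j = a) :
    {x₀ : Kˣ |
        ((Valued.v (h * ((x₀ : K) * Θ x₀) * (ϖ ^ j * (α - ρ α))) ≤ 1 ∧
              Valued.v (h * ((x₀ : K) * Θ x₀) * (ϖ ^ j * (α - ρ α)) - ρ (h * ((x₀ : K) * Θ x₀) * (ϖ ^ j * (α - ρ α)))) ≤ Valued.v (ϖ ^ j * (α - ρ α))) ∧
            ¬ (Valued.v (h * ((x₀ : K) * Θ x₀) * (ϖ ^ j * (α - ρ α)) / ϖ) ≤ 1 ∧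
                Valued.v (h * ((x₀ : K) * Θ x₀) * (ϖ ^ j * (α - ρ α)) / ϖ - ρ (h * ((x₀ : K) * Θ x₀) * (ϖ ^ j * (α - ρ α)) / ϖ)) ≤
                  Valued.v (ϖ ^ j * (α - ρ α)))) ∧
          Valued.v (h * ((x₀ : K) * Θ x₀) * (ϖ ^ j * (α - ρ α))) = exp (-(a : ℤ))} =
      (Units.mk0 ϖ hϖ0 ^ k₀) • {ω : Kˣ | Valued.v (ω : K) = 1 ∧ Valued.v (1 + ρ h / h * (ρ ((ω : K) * Θ ω) / ((ω : K) * Θ ω))) = exp ((a : ℤ) - j)} := by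
  have hcoe : ∀ (ω : Kˣ), (((Units.mk0 ϖ hϖ0 ^ k₀ * ω : Kˣ)) : K) = ϖ ^ k₀ * ω := fun ω => by
    rw [Units.val_mul, Units.val_zpow_eq_zpow_val, Units.val_mk0]
  ext x₀
  rw [Set.mem_setOf_eq, Set.mem_smul_set]
  constructor
  · intro hP
    obtain ⟨k, ω, hω, hx⟩ := exists_eq_varpi_zpow_mul_unit hϖ x₀.ne_zero
    rw [hx] at hP
    obtain ⟨hkj, hdep⟩ := (hermGen_level_iff_of_pos hρρ hΘρ hvΘ hα hϖ hρϖ hh hvh j ha hω).1 hP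
    have hk : k = k₀ := by omega
    have hω0 : ω ≠ 0 := fun h0 => by rw [h0, map_zero] at hω; exact zero_ne_one hω
    refine ⟨Units.mk0 ω hω0, ⟨by rw [Units.val_mk0]; exact hω, by rw [Units.val_mk0]; exact hdep⟩, Units.ext ?_⟩
    rw [smul_eq_mul, hcoe, Units.val_mk0, ← hk, ← hx]
  · rintro ⟨ω, ⟨hω, hdep⟩, rfl⟩
    rw [smul_eq_mul, hcoe]
    exact (hermGen_level_iff_of_pos hρρ hΘρ hvΘ hα hϖ hρϖ hh hvh j ha hω).2 ⟨hk₀, hdep⟩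

/-- **THE LEVEL-`0` GENERATORS, EVEN PARITY**: with `2k₀ = −j − v_h`, they are `ϖ^{k₀}·{ω : |ω| = 1, |1 + η·t(ω)| ≤ exp(−j)}`. [cite: Jacobowitz1962, §4] -/
theorem setOf_levelGen_eq_smul_zero (hρρ : ∀ x, ρ (ρ x) = x) (hΘρ : ∀ x, Θ (ρ x) = ρ (Θ x)) (hvΘ : ∀ x, Valued.v (Θ x) = Valued.v x)
    (hα : Valued.v (α - ρ α) = 1) (hϖ : Valued.v ϖ = exp (-1 : ℤ)) (hρϖ : ρ ϖ = ϖ) (hϖ0 : ϖ ≠ 0) (hh : h ≠ 0) {vh : ℤ} (hvh : Valued.v h = exp (-vh))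
    (j : ℕ) {k₀ : ℤ} (hk₀ : vh + 2 * k₀ + j = 0) :
    {x₀ : Kˣ |
        ((Valued.v (h * ((x₀ : K) * Θ x₀) * (ϖ ^ j * (α - ρ α))) ≤ 1 ∧
              Valued.v (h * ((x₀ : K) * Θ x₀) * (ϖ ^ j * (α - ρ α)) - ρ (h * ((x₀ : K) * Θ x₀) * (ϖ ^ j * (α - ρ α)))) ≤ Valued.v (ϖ ^ j * (α - ρ α))) ∧
            ¬ (Valued.v (h * ((x₀ : K) * Θ x₀) * (ϖ ^ j * (α - ρ α)) / ϖ) ≤ 1 ∧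
                Valued.v (h * ((x₀ : K) * Θ x₀) * (ϖ ^ j * (α - ρ α)) / ϖ - ρ (h * ((x₀ : K) * Θ x₀) * (ϖ ^ j * (α - ρ α)) / ϖ)) ≤
                  Valued.v (ϖ ^ j * (α - ρ α)))) ∧
          Valued.v (h * ((x₀ : K) * Θ x₀) * (ϖ ^ j * (α - ρ α))) = exp (-((0 : ℕ) : ℤ))} =
      (Units.mk0 ϖ hϖ0 ^ k₀) • {ω : Kˣ | Valued.v (ω : K) = 1 ∧ Valued.v (1 + ρ h / h * (ρ ((ω : K) * Θ ω) / ((ω : K) * Θ ω))) ≤ exp (-(j : ℤ))} := by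
  have hcoe : ∀ (ω : Kˣ), (((Units.mk0 ϖ hϖ0 ^ k₀ * ω : Kˣ)) : K) = ϖ ^ k₀ * ω := fun ω => by
    rw [Units.val_mul, Units.val_zpow_eq_zpow_val, Units.val_mk0]
  ext x₀
  rw [Set.mem_setOf_eq, Set.mem_smul_set]
  constructor
  · intro hP
    obtain ⟨k, ω, hω, hx⟩ := exists_eq_varpi_zpow_mul_unit hϖ x₀.ne_zero
    rw [hx] at hP
    obtain ⟨hkj, hdep⟩ := (hermGen_level_iff_zero hρρ hΘρ hvΘ hα hϖ hρϖ hh hvh j hω).1 hP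
    have hk : k = k₀ := by omega
    have hω0 : ω ≠ 0 := fun h0 => by rw [h0, map_zero] at hω; exact zero_ne_one hω
    refine ⟨Units.mk0 ω hω0, ⟨by rw [Units.val_mk0]; exact hω, by rw [Units.val_mk0]; exact hdep⟩, Units.ext ?_⟩
    rw [smul_eq_mul, hcoe, Units.val_mk0, ← hk, ← hx]
  · rintro ⟨ω, ⟨hω, hdep⟩, rfl⟩
    rw [smul_eq_mul, hcoe]
    exact (hermGen_level_iff_zero hρρ hΘρ hvΘ hα hϖ hρϖ hh hvh j hω).2 ⟨hk₀, hdep⟩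

/-- **ODD PARITY: NO GENERATORS** — if `a − j − v_h` is odd, no `x₀` generates a level-`a` member (the level equation `v_h + 2k + j = a` has no solution). [cite: Jacobowitz1962, §4] -/
theorem setOf_levelGen_eq_empty_of_odd (hvΘ : ∀ x, Valued.v (Θ x) = Valued.v x)
    (hα : Valued.v (α - ρ α) = 1) (hϖ : Valued.v ϖ = exp (-1 : ℤ)) {vh : ℤ} (hvh : Valued.v h = exp (-vh))
    (j a : ℕ) (hodd : ∀ k : ℤ, vh + 2 * k + j ≠ a) :
    {x₀ : Kˣ |
        ((Valued.v (h * ((x₀ : K) * Θ x₀) * (ϖ ^ j * (α - ρ α))) ≤ 1 ∧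
              Valued.v (h * ((x₀ : K) * Θ x₀) * (ϖ ^ j * (α - ρ α)) - ρ (h * ((x₀ : K) * Θ x₀) * (ϖ ^ j * (α - ρ α)))) ≤ Valued.v (ϖ ^ j * (α - ρ α))) ∧
            ¬ (Valued.v (h * ((x₀ : K) * Θ x₀) * (ϖ ^ j * (α - ρ α)) / ϖ) ≤ 1 ∧
                Valued.v (h * ((x₀ : K) * Θ x₀) * (ϖ ^ j * (α - ρ α)) / ϖ - ρ (h * ((x₀ : K) * Θ x₀) * (ϖ ^ j * (α - ρ α)) / ϖ)) ≤
                  Valued.v (ϖ ^ j * (α - ρ α)))) ∧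
          Valued.v (h * ((x₀ : K) * Θ x₀) * (ϖ ^ j * (α - ρ α))) = exp (-(a : ℤ))} = ∅ := by
  ext x₀
  simp only [Set.mem_setOf_eq, Set.mem_empty_iff_false, iff_false, not_and]
  intro _ hlev
  obtain ⟨k, ω, hω, hx⟩ := exists_eq_varpi_zpow_mul_unit hϖ x₀.ne_zero
  rw [hx, v_hermGen_varpi_zpow_mul (ρ := ρ) hvΘ hα hϖ hvh j hω, exp_inj] at hlev
  exact hodd k (by omega)

/-- **THE EXACT-DEPTH SET IS A DIFFERENCE OF TWO DEPTH SETS** (`a ≥ 1`): `{|1 + ηt| = exp(a − j)} = {|1 + ηt| ≤ exp(−(j − a))} ∖ {|1 + ηt| ≤ exp(−(j − a + 1))}`. [cite: Serre1979, Ch. V §1] -/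
theorem setOf_depth_eq_diff (j a : ℕ) :
    {ω : Kˣ | Valued.v (ω : K) = 1 ∧ Valued.v (1 + ρ h / h * (ρ ((ω : K) * Θ ω) / ((ω : K) * Θ ω))) = exp ((a : ℤ) - j)} =
      {ω : Kˣ | Valued.v (ω : K) = 1 ∧ Valued.v (1 + ρ h / h * (ρ ((ω : K) * Θ ω) / ((ω : K) * Θ ω))) ≤ exp (-((j : ℤ) - a))} \
        {ω : Kˣ | Valued.v (ω : K) = 1 ∧ Valued.v (1 + ρ h / h * (ρ ((ω : K) * Θ ω) / ((ω : K) * Θ ω))) ≤ exp (-((j : ℤ) - a + 1))} := by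
  ext ω
  simp only [Set.mem_setOf_eq, Set.mem_sdiff, not_and]
  rw [v_eq_exp_iff_le_and_not_le]
  have h1 : -((j : ℤ) - a) = (a : ℤ) - j := by ring
  have h2 : -((j : ℤ) - a + 1) = (a : ℤ) - j - 1 := by ring
  rw [h1, h2]
  constructor
  · rintro ⟨hω, hle, hnot⟩; exact ⟨⟨hω, hle⟩, fun _ => hnot⟩
  · rintro ⟨⟨hω, hle⟩, hnot⟩; exact ⟨hω, hle, hnot hω⟩

/-- **THE COUNT, `a ≥ 1` (hyperbolic side, even parity)**: for the order units `H = 𝒪_jˣ` and the two norm-depth subgroups `B ⊇ B′` at depths `exp(−(j−a))`, `exp(−(j−a+1))`, a unit translator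
`ω₀` (`η·t(ω₀) = −1`) and `H ≤ B′`: the order lattices with an integral Gram-primitive dual generator of level `a` number **`[B : H] − [B′ : H]`** (as `H.relIndex B − H.relIndex B′`;
finiteness of the larger count as a binder). [cite: Flicker1998UnitaryFL, p. 84] [cite: Serre1979, Ch. V §3] -/
theorem ncard_levelSet_eq_relIndex_sub (hρρ : ∀ x, ρ (ρ x) = x) (hvρ : ∀ x, Valued.v (ρ x) = Valued.v x) (hΘρ : ∀ x, Θ (ρ x) = ρ (Θ x))
    (hvΘ : ∀ x, Valued.v (Θ x) = Valued.v x) (hα : Valued.v (α - ρ α) = 1) (hϖ : Valued.v ϖ = exp (-1 : ℤ)) (hρϖ : ρ ϖ = ϖ) (hh : h ≠ 0)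
    {vh : ℤ} (hvh : Valued.v h = exp (-vh)) (j : ℕ) {a : ℕ} (ha : 1 ≤ a) {k₀ : ℤ} (hk₀ : vh + 2 * k₀ + j = a)
    {ω₀ : Kˣ} (hω₀ : Valued.v (ω₀ : K) = 1) (hη : ρ h / h * (ρ ((ω₀ : K) * Θ ω₀) / ((ω₀ : K) * Θ ω₀)) = -1)
    (H B B' : Subgroup Kˣ) (hH : ∀ u : Kˣ, u ∈ H ↔ Valued.v (u : K) = 1 ∧ Valued.v ((u : K) - ρ u) ≤ Valued.v (ϖ ^ j * (α - ρ α)))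
    (hB : ∀ ω : Kˣ, ω ∈ B ↔ Valued.v (ω : K) = 1 ∧ Valued.v ((ω : K) * Θ ω - ρ ((ω : K) * Θ ω)) ≤ exp (-((j : ℤ) - a)))
    (hB' : ∀ ω : Kˣ, ω ∈ B' ↔ Valued.v (ω : K) = 1 ∧ Valued.v ((ω : K) * Θ ω - ρ ((ω : K) * Θ ω)) ≤ exp (-((j : ℤ) - a + 1)))
    (hHB' : H ≤ B') (hfin : ((QuotientGroup.mk : Kˣ → Kˣ ⧸ H) '' (ω₀ • (B : Set Kˣ))).Finite) :
    {Λ : AddSubgroup K | ∃ x₀ : K, x₀ ≠ 0 ∧ (∀ x, x ∈ Λ ↔ ∃ z, (Valued.v z ≤ 1 ∧ Valued.v (z - ρ z) ≤ Valued.v (ϖ ^ j * (α - ρ α))) ∧ x = x₀ * z) ∧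
        ((Valued.v (h * (x₀ * Θ x₀) * (ϖ ^ j * (α - ρ α))) ≤ 1 ∧
              Valued.v (h * (x₀ * Θ x₀) * (ϖ ^ j * (α - ρ α)) - ρ (h * (x₀ * Θ x₀) * (ϖ ^ j * (α - ρ α)))) ≤ Valued.v (ϖ ^ j * (α - ρ α))) ∧
            ¬ (Valued.v (h * (x₀ * Θ x₀) * (ϖ ^ j * (α - ρ α)) / ϖ) ≤ 1 ∧
                Valued.v (h * (x₀ * Θ x₀) * (ϖ ^ j * (α - ρ α)) / ϖ - ρ (h * (x₀ * Θ x₀) * (ϖ ^ j * (α - ρ α)) / ϖ)) ≤ Valued.v (ϖ ^ j * (α - ρ α)))) ∧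
          Valued.v (h * (x₀ * Θ x₀) * (ϖ ^ j * (α - ρ α))) = exp (-(a : ℤ))}.ncard =
      H.relIndex B - H.relIndex B' := by
  have hϖ0 : ϖ ≠ 0 := (v_varpi_zpow hϖ 0).1
  -- Step A: lattices ↔ cosets (★ F1)
  have hA := ncard_setOf_orderLattice_eq_ncard_image_mk hvρ hH (fun x₀ : Kˣ =>
    ((Valued.v (h * ((x₀ : K) * Θ x₀) * (ϖ ^ j * (α - ρ α))) ≤ 1 ∧
          Valued.v (h * ((x₀ : K) * Θ x₀) * (ϖ ^ j * (α - ρ α)) - ρ (h * ((x₀ : K) * Θ x₀) * (ϖ ^ j * (α - ρ α)))) ≤ Valued.v (ϖ ^ j * (α - ρ α))) ∧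
        ¬ (Valued.v (h * ((x₀ : K) * Θ x₀) * (ϖ ^ j * (α - ρ α)) / ϖ) ≤ 1 ∧
            Valued.v (h * ((x₀ : K) * Θ x₀) * (ϖ ^ j * (α - ρ α)) / ϖ - ρ (h * ((x₀ : K) * Θ x₀) * (ϖ ^ j * (α - ρ α)) / ϖ)) ≤ Valued.v (ϖ ^ j * (α - ρ α)))) ∧
      Valued.v (h * ((x₀ : K) * Θ x₀) * (ϖ ^ j * (α - ρ α))) = exp (-(a : ℤ)))
  have hsets : {Λ : AddSubgroup K | ∃ x₀ : K, x₀ ≠ 0 ∧ (∀ x, x ∈ Λ ↔ ∃ z, (Valued.v z ≤ 1 ∧ Valued.v (z - ρ z) ≤ Valued.v (ϖ ^ j * (α - ρ α))) ∧ x = x₀ * z) ∧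
        ((Valued.v (h * (x₀ * Θ x₀) * (ϖ ^ j * (α - ρ α))) ≤ 1 ∧
              Valued.v (h * (x₀ * Θ x₀) * (ϖ ^ j * (α - ρ α)) - ρ (h * (x₀ * Θ x₀) * (ϖ ^ j * (α - ρ α)))) ≤ Valued.v (ϖ ^ j * (α - ρ α))) ∧
            ¬ (Valued.v (h * (x₀ * Θ x₀) * (ϖ ^ j * (α - ρ α)) / ϖ) ≤ 1 ∧
                Valued.v (h * (x₀ * Θ x₀) * (ϖ ^ j * (α - ρ α)) / ϖ - ρ (h * (x₀ * Θ x₀) * (ϖ ^ j * (α - ρ α)) / ϖ)) ≤ Valued.v (ϖ ^ j * (α - ρ α)))) ∧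
          Valued.v (h * (x₀ * Θ x₀) * (ϖ ^ j * (α - ρ α))) = exp (-(a : ℤ))} =
      {Λ : AddSubgroup K | ∃ x₀ : Kˣ,
        (((Valued.v (h * ((x₀ : K) * Θ x₀) * (ϖ ^ j * (α - ρ α))) ≤ 1 ∧
              Valued.v (h * ((x₀ : K) * Θ x₀) * (ϖ ^ j * (α - ρ α)) - ρ (h * ((x₀ : K) * Θ x₀) * (ϖ ^ j * (α - ρ α)))) ≤ Valued.v (ϖ ^ j * (α - ρ α))) ∧
            ¬ (Valued.v (h * ((x₀ : K) * Θ x₀) * (ϖ ^ j * (α - ρ α)) / ϖ) ≤ 1 ∧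
                Valued.v (h * ((x₀ : K) * Θ x₀) * (ϖ ^ j * (α - ρ α)) / ϖ - ρ (h * ((x₀ : K) * Θ x₀) * (ϖ ^ j * (α - ρ α)) / ϖ)) ≤
                  Valued.v (ϖ ^ j * (α - ρ α)))) ∧
          Valued.v (h * ((x₀ : K) * Θ x₀) * (ϖ ^ j * (α - ρ α))) = exp (-(a : ℤ))) ∧
        ∀ x, x ∈ Λ ↔ ∃ y, (Valued.v y ≤ 1 ∧ Valued.v (y - ρ y) ≤ Valued.v (ϖ ^ j * (α - ρ α))) ∧ x = (x₀ : K) * y} := by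
    ext Λ
    simp only [Set.mem_setOf_eq]
    constructor
    · rintro ⟨x₀, hx₀, hmem, hP⟩; exact ⟨Units.mk0 x₀ hx₀, hP, hmem⟩
    · rintro ⟨x₀, hP, hmem⟩; exact ⟨(x₀ : K), x₀.ne_zero, hmem, hP⟩
  rw [hsets, hA, setOf_levelGen_eq_smul_of_pos hρρ hΘρ hvΘ hα hϖ hρϖ hϖ0 hh hvh j ha hk₀, ncard_image_mk_smul, setOf_depth_eq_diff,
    setOf_v_one_add_mul_twist_le_eq_smul hvΘ hω₀ hη _ hB, setOf_v_one_add_mul_twist_le_eq_smul hvΘ hω₀ hη _ hB']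
  rw [ncard_image_mk_diff H ?_ ?_ hfin, ncard_image_mk_smul_subgroup, ncard_image_mk_smul_subgroup]
  · -- `ω₀·B′ ⊆ ω₀·B`
    refine Set.smul_set_mono ?_
    intro ω hω
    obtain ⟨h1, h2⟩ := (hB' ω).1 hω
    exact (hB ω).2 ⟨h1, h2.trans (by rw [exp_le_exp]; omega)⟩
  · -- `ω₀·B′` is `H`-saturated
    intro x hx u hu
    obtain ⟨b, hb, rfl⟩ := Set.mem_smul_set.1 hx
    refine Set.mem_smul_set.2 ⟨u * b, B'.mul_mem (hHB' hu) hb, ?_⟩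
    simp only [smul_eq_mul]; rw [mul_left_comm]

/-- **THE COUNT, `a = 0` (hyperbolic side, even parity)**: the level-`0` order lattices number `[B_j : H]` (`B_j` at depth `exp(−j)`). [cite: Flicker1998UnitaryFL, p. 84] -/
theorem ncard_levelSet_zero_eq_relIndex (hρρ : ∀ x, ρ (ρ x) = x) (hvρ : ∀ x, Valued.v (ρ x) = Valued.v x) (hΘρ : ∀ x, Θ (ρ x) = ρ (Θ x))
    (hvΘ : ∀ x, Valued.v (Θ x) = Valued.v x) (hα : Valued.v (α - ρ α) = 1) (hϖ : Valued.v ϖ = exp (-1 : ℤ)) (hρϖ : ρ ϖ = ϖ) (hh : h ≠ 0)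
    {vh : ℤ} (hvh : Valued.v h = exp (-vh)) (j : ℕ) {k₀ : ℤ} (hk₀ : vh + 2 * k₀ + j = 0)
    {ω₀ : Kˣ} (hω₀ : Valued.v (ω₀ : K) = 1) (hη : ρ h / h * (ρ ((ω₀ : K) * Θ ω₀) / ((ω₀ : K) * Θ ω₀)) = -1)
    (H B : Subgroup Kˣ) (hH : ∀ u : Kˣ, u ∈ H ↔ Valued.v (u : K) = 1 ∧ Valued.v ((u : K) - ρ u) ≤ Valued.v (ϖ ^ j * (α - ρ α)))
    (hB : ∀ ω : Kˣ, ω ∈ B ↔ Valued.v (ω : K) = 1 ∧ Valued.v ((ω : K) * Θ ω - ρ ((ω : K) * Θ ω)) ≤ exp (-(j : ℤ))) :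
    {Λ : AddSubgroup K | ∃ x₀ : K, x₀ ≠ 0 ∧ (∀ x, x ∈ Λ ↔ ∃ z, (Valued.v z ≤ 1 ∧ Valued.v (z - ρ z) ≤ Valued.v (ϖ ^ j * (α - ρ α))) ∧ x = x₀ * z) ∧
        ((Valued.v (h * (x₀ * Θ x₀) * (ϖ ^ j * (α - ρ α))) ≤ 1 ∧
              Valued.v (h * (x₀ * Θ x₀) * (ϖ ^ j * (α - ρ α)) - ρ (h * (x₀ * Θ x₀) * (ϖ ^ j * (α - ρ α)))) ≤ Valued.v (ϖ ^ j * (α - ρ α))) ∧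
            ¬ (Valued.v (h * (x₀ * Θ x₀) * (ϖ ^ j * (α - ρ α)) / ϖ) ≤ 1 ∧
                Valued.v (h * (x₀ * Θ x₀) * (ϖ ^ j * (α - ρ α)) / ϖ - ρ (h * (x₀ * Θ x₀) * (ϖ ^ j * (α - ρ α)) / ϖ)) ≤ Valued.v (ϖ ^ j * (α - ρ α)))) ∧
          Valued.v (h * (x₀ * Θ x₀) * (ϖ ^ j * (α - ρ α))) = exp (-((0 : ℕ) : ℤ))}.ncard = H.relIndex B := by
  have hϖ0 : ϖ ≠ 0 := (v_varpi_zpow hϖ 0).1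
  have hA := ncard_setOf_orderLattice_eq_ncard_image_mk hvρ hH (fun x₀ : Kˣ =>
    ((Valued.v (h * ((x₀ : K) * Θ x₀) * (ϖ ^ j * (α - ρ α))) ≤ 1 ∧
          Valued.v (h * ((x₀ : K) * Θ x₀) * (ϖ ^ j * (α - ρ α)) - ρ (h * ((x₀ : K) * Θ x₀) * (ϖ ^ j * (α - ρ α)))) ≤ Valued.v (ϖ ^ j * (α - ρ α))) ∧
        ¬ (Valued.v (h * ((x₀ : K) * Θ x₀) * (ϖ ^ j * (α - ρ α)) / ϖ) ≤ 1 ∧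
            Valued.v (h * ((x₀ : K) * Θ x₀) * (ϖ ^ j * (α - ρ α)) / ϖ - ρ (h * ((x₀ : K) * Θ x₀) * (ϖ ^ j * (α - ρ α)) / ϖ)) ≤ Valued.v (ϖ ^ j * (α - ρ α)))) ∧
      Valued.v (h * ((x₀ : K) * Θ x₀) * (ϖ ^ j * (α - ρ α))) = exp (-((0 : ℕ) : ℤ)))
  have hsets : {Λ : AddSubgroup K | ∃ x₀ : K, x₀ ≠ 0 ∧ (∀ x, x ∈ Λ ↔ ∃ z, (Valued.v z ≤ 1 ∧ Valued.v (z - ρ z) ≤ Valued.v (ϖ ^ j * (α - ρ α))) ∧ x = x₀ * z) ∧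
        ((Valued.v (h * (x₀ * Θ x₀) * (ϖ ^ j * (α - ρ α))) ≤ 1 ∧
              Valued.v (h * (x₀ * Θ x₀) * (ϖ ^ j * (α - ρ α)) - ρ (h * (x₀ * Θ x₀) * (ϖ ^ j * (α - ρ α)))) ≤ Valued.v (ϖ ^ j * (α - ρ α))) ∧
            ¬ (Valued.v (h * (x₀ * Θ x₀) * (ϖ ^ j * (α - ρ α)) / ϖ) ≤ 1 ∧
                Valued.v (h * (x₀ * Θ x₀) * (ϖ ^ j * (α - ρ α)) / ϖ - ρ (h * (x₀ * Θ x₀) * (ϖ ^ j * (α - ρ α)) / ϖ)) ≤ Valued.v (ϖ ^ j * (α - ρ α)))) ∧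
          Valued.v (h * (x₀ * Θ x₀) * (ϖ ^ j * (α - ρ α))) = exp (-((0 : ℕ) : ℤ))} =
      {Λ : AddSubgroup K | ∃ x₀ : Kˣ,
        (((Valued.v (h * ((x₀ : K) * Θ x₀) * (ϖ ^ j * (α - ρ α))) ≤ 1 ∧
              Valued.v (h * ((x₀ : K) * Θ x₀) * (ϖ ^ j * (α - ρ α)) - ρ (h * ((x₀ : K) * Θ x₀) * (ϖ ^ j * (α - ρ α)))) ≤ Valued.v (ϖ ^ j * (α - ρ α))) ∧
            ¬ (Valued.v (h * ((x₀ : K) * Θ x₀) * (ϖ ^ j * (α - ρ α)) / ϖ) ≤ 1 ∧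
                Valued.v (h * ((x₀ : K) * Θ x₀) * (ϖ ^ j * (α - ρ α)) / ϖ - ρ (h * ((x₀ : K) * Θ x₀) * (ϖ ^ j * (α - ρ α)) / ϖ)) ≤
                  Valued.v (ϖ ^ j * (α - ρ α)))) ∧
          Valued.v (h * ((x₀ : K) * Θ x₀) * (ϖ ^ j * (α - ρ α))) = exp (-((0 : ℕ) : ℤ))) ∧
        ∀ x, x ∈ Λ ↔ ∃ y, (Valued.v y ≤ 1 ∧ Valued.v (y - ρ y) ≤ Valued.v (ϖ ^ j * (α - ρ α))) ∧ x = (x₀ : K) * y} := by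
    ext Λ
    simp only [Set.mem_setOf_eq]
    constructor
    · rintro ⟨x₀, hx₀, hmem, hP⟩; exact ⟨Units.mk0 x₀ hx₀, hP, hmem⟩
    · rintro ⟨x₀, hP, hmem⟩; exact ⟨(x₀ : K), x₀.ne_zero, hmem, hP⟩
  rw [hsets, hA, setOf_levelGen_eq_smul_zero hρρ hΘρ hvΘ hα hϖ hρϖ hϖ0 hh hvh j hk₀, ncard_image_mk_smul,
    setOf_v_one_add_mul_twist_le_eq_smul hvΘ hω₀ hη _ hB, ncard_image_mk_smul_subgroup]

/-- **ODD PARITY: THE COUNT IS `0`** (both sides; no translator needed). [cite: Flicker1998UnitaryFL, p. 84] -/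
theorem ncard_levelSet_eq_zero_of_odd (hvρ : ∀ x, Valued.v (ρ x) = Valued.v x) (hvΘ : ∀ x, Valued.v (Θ x) = Valued.v x)
    (hα : Valued.v (α - ρ α) = 1) (hϖ : Valued.v ϖ = exp (-1 : ℤ)) {vh : ℤ} (hvh : Valued.v h = exp (-vh))
    (j a : ℕ) (hodd : ∀ k : ℤ, vh + 2 * k + j ≠ a)
    (H : Subgroup Kˣ) (hH : ∀ u : Kˣ, u ∈ H ↔ Valued.v (u : K) = 1 ∧ Valued.v ((u : K) - ρ u) ≤ Valued.v (ϖ ^ j * (α - ρ α))) :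
    {Λ : AddSubgroup K | ∃ x₀ : K, x₀ ≠ 0 ∧ (∀ x, x ∈ Λ ↔ ∃ z, (Valued.v z ≤ 1 ∧ Valued.v (z - ρ z) ≤ Valued.v (ϖ ^ j * (α - ρ α))) ∧ x = x₀ * z) ∧
        ((Valued.v (h * (x₀ * Θ x₀) * (ϖ ^ j * (α - ρ α))) ≤ 1 ∧
              Valued.v (h * (x₀ * Θ x₀) * (ϖ ^ j * (α - ρ α)) - ρ (h * (x₀ * Θ x₀) * (ϖ ^ j * (α - ρ α)))) ≤ Valued.v (ϖ ^ j * (α - ρ α))) ∧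
            ¬ (Valued.v (h * (x₀ * Θ x₀) * (ϖ ^ j * (α - ρ α)) / ϖ) ≤ 1 ∧
                Valued.v (h * (x₀ * Θ x₀) * (ϖ ^ j * (α - ρ α)) / ϖ - ρ (h * (x₀ * Θ x₀) * (ϖ ^ j * (α - ρ α)) / ϖ)) ≤ Valued.v (ϖ ^ j * (α - ρ α)))) ∧
          Valued.v (h * (x₀ * Θ x₀) * (ϖ ^ j * (α - ρ α))) = exp (-(a : ℤ))}.ncard = 0 := by
  have hA := ncard_setOf_orderLattice_eq_ncard_image_mk hvρ hH (fun x₀ : Kˣ =>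
    ((Valued.v (h * ((x₀ : K) * Θ x₀) * (ϖ ^ j * (α - ρ α))) ≤ 1 ∧
          Valued.v (h * ((x₀ : K) * Θ x₀) * (ϖ ^ j * (α - ρ α)) - ρ (h * ((x₀ : K) * Θ x₀) * (ϖ ^ j * (α - ρ α)))) ≤ Valued.v (ϖ ^ j * (α - ρ α))) ∧
        ¬ (Valued.v (h * ((x₀ : K) * Θ x₀) * (ϖ ^ j * (α - ρ α)) / ϖ) ≤ 1 ∧
            Valued.v (h * ((x₀ : K) * Θ x₀) * (ϖ ^ j * (α - ρ α)) / ϖ - ρ (h * ((x₀ : K) * Θ x₀) * (ϖ ^ j * (α - ρ α)) / ϖ)) ≤ Valued.v (ϖ ^ j * (α - ρ α)))) ∧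
      Valued.v (h * ((x₀ : K) * Θ x₀) * (ϖ ^ j * (α - ρ α))) = exp (-(a : ℤ)))
  have hsets : {Λ : AddSubgroup K | ∃ x₀ : K, x₀ ≠ 0 ∧ (∀ x, x ∈ Λ ↔ ∃ z, (Valued.v z ≤ 1 ∧ Valued.v (z - ρ z) ≤ Valued.v (ϖ ^ j * (α - ρ α))) ∧ x = x₀ * z) ∧
        ((Valued.v (h * (x₀ * Θ x₀) * (ϖ ^ j * (α - ρ α))) ≤ 1 ∧
              Valued.v (h * (x₀ * Θ x₀) * (ϖ ^ j * (α - ρ α)) - ρ (h * (x₀ * Θ x₀) * (ϖ ^ j * (α - ρ α)))) ≤ Valued.v (ϖ ^ j * (α - ρ α))) ∧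
            ¬ (Valued.v (h * (x₀ * Θ x₀) * (ϖ ^ j * (α - ρ α)) / ϖ) ≤ 1 ∧
                Valued.v (h * (x₀ * Θ x₀) * (ϖ ^ j * (α - ρ α)) / ϖ - ρ (h * (x₀ * Θ x₀) * (ϖ ^ j * (α - ρ α)) / ϖ)) ≤ Valued.v (ϖ ^ j * (α - ρ α)))) ∧
          Valued.v (h * (x₀ * Θ x₀) * (ϖ ^ j * (α - ρ α))) = exp (-(a : ℤ))} =
      {Λ : AddSubgroup K | ∃ x₀ : Kˣ,
        (((Valued.v (h * ((x₀ : K) * Θ x₀) * (ϖ ^ j * (α - ρ α))) ≤ 1 ∧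
              Valued.v (h * ((x₀ : K) * Θ x₀) * (ϖ ^ j * (α - ρ α)) - ρ (h * ((x₀ : K) * Θ x₀) * (ϖ ^ j * (α - ρ α)))) ≤ Valued.v (ϖ ^ j * (α - ρ α))) ∧
            ¬ (Valued.v (h * ((x₀ : K) * Θ x₀) * (ϖ ^ j * (α - ρ α)) / ϖ) ≤ 1 ∧
                Valued.v (h * ((x₀ : K) * Θ x₀) * (ϖ ^ j * (α - ρ α)) / ϖ - ρ (h * ((x₀ : K) * Θ x₀) * (ϖ ^ j * (α - ρ α)) / ϖ)) ≤
                  Valued.v (ϖ ^ j * (α - ρ α)))) ∧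
          Valued.v (h * ((x₀ : K) * Θ x₀) * (ϖ ^ j * (α - ρ α))) = exp (-(a : ℤ))) ∧
        ∀ x, x ∈ Λ ↔ ∃ y, (Valued.v y ≤ 1 ∧ Valued.v (y - ρ y) ≤ Valued.v (ϖ ^ j * (α - ρ α))) ∧ x = (x₀ : K) * y} := by
    ext Λ
    simp only [Set.mem_setOf_eq]
    constructor
    · rintro ⟨x₀, hx₀, hmem, hP⟩; exact ⟨Units.mk0 x₀ hx₀, hP, hmem⟩
    · rintro ⟨x₀, hP, hmem⟩; exact ⟨(x₀ : K), x₀.ne_zero, hmem, hP⟩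
  rw [hsets, hA, setOf_levelGen_eq_empty_of_odd (ρ := ρ) (Θ := Θ) hvΘ hα hϖ hvh j a hodd, Set.image_empty, Set.ncard_empty]

end Literature.NumberTheory.LocalFields.QuadraticOrder
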